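import Literature.MathematicalPhysics.QuantumLattice.YangMillsHodgeDualField
import Literature.MathematicalPhysics.QuantumLattice.LatticeWilsonFlow
import Literature.Analysis.Calculus.SphereTangentialMean
import HarnessLib

/-!
# The covariant gap `3` on `S_r ⊂ ℝ⁴` for the Hodge-dual field in a small gauge

QuantumLattice support file (everything proved; no definitions, no named facts) on the proof
path of `Literature.MathematicalPhysics.QuantumLattice.Waldron2019_yangMillsFlow_flatTorus`
(A. Waldron, Invent. math. 217 (2019)), Lemma 3.5(a) in the `u = ⋆(x ∧ F)` formalism: for a
`C³` matrix-valued connection `B` on `ℝ⁴` which is SMALL on the sphere `S_r`,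
`‖B(y)v‖ ≤ (δ/r)‖v‖` (`0 < δ ≤ 1`), the Hodge-dual sections `u_a = hodgeSec e B a` satisfy
`3 ∑ₐ ∮_{S_r}‖u_a‖² ≤ (1 + δ) · ½∑ᵢⱼ∑ₐ ∮_{S_r}‖D_{L_{ij}} u_a‖² + 304 δ ∑ₐ ∮_{S_r}‖u_a‖²`
(`sphere_covariant_gap_small`): the flat gap `sphere_gap_tangential` (tangency of `u`,
`sum_inner_smul_hodgeSec_eq_zero`) plus `∂ = D − [B, ·]`, where the flat divergence
`∑ₐ ∂ₐu_a = −∑ₐ [B_a, u_a]` is small by the Bianchi identity `∑ₐ D_a u_a = 0`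
(`sum_covDeriv_hodgeSec_eq_zero`). Since both sides are gauge invariant, this is Waldron's
Lemma 3.5(a) (first eigenvalue `4 − Cε` on closed 2-forms) once a small gauge exists.

References: A. Waldron, Invent. math. 217 (2019), Lemma 3.5(a) [Waldron2019]; [folklore].
-/

noncomputable section

open scoped BigOperators RealInnerProductSpace Matrix.Norms.Frobenius
open MeasureTheory Metric Set
open Literature.Analysis.FluidPDE Literature.Analysis.Calculus Literature.Analysis.Calculus.MvPoly
  Literature.Analysis.InnerProduct

namespace Literature.MathematicalPhysics.QuantumLattice

attribute [local instance] frobeniusInnerProductSpace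

variable {m : Type*} [Fintype m] [DecidableEq m]

local notation "𝔼" => EuclideanSpace ℝ (Fin 4)
local notation "𝕓" => EuclideanSpace.basisFun (Fin 4) ℝ
local notation "𝔤" => Matrix m m ℂ

/-! ### Pointwise algebra -/

/-- `‖[a, b]‖ ≤ 2‖a‖‖b‖`. [folklore] -/
theorem norm_lie_le' (a b : 𝔤) : ‖⁅a, b⁆‖ ≤ 2 * ‖a‖ * ‖b‖ := by
  rw [Ring.lie_def]
  calc ‖a * b - b * a‖ ≤ ‖a * b‖ + ‖b * a‖ := norm_sub_le _ _
    _ ≤ ‖a‖ * ‖b‖ + ‖b‖ * ‖a‖ := add_le_add (norm_mul_le _ _) (norm_mul_le _ _)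
    _ = 2 * ‖a‖ * ‖b‖ := by ring

/-- `‖p − q‖² ≤ (1 + η)‖p‖² + (1 + 1/η)‖q‖²` for `η > 0`. [folklore] -/
theorem norm_sub_sq_le_weighted {V : Type*} [NormedAddCommGroup V] (p q : V) {η : ℝ} (hη : 0 < η) :
    ‖p - q‖ ^ 2 ≤ (1 + η) * ‖p‖ ^ 2 + (1 + 1 / η) * ‖q‖ ^ 2 := by
  have h1 : ‖p - q‖ ≤ ‖p‖ + ‖q‖ := norm_sub_le p q
  have h2 : ‖p - q‖ ^ 2 ≤ (‖p‖ + ‖q‖) ^ 2 := pow_le_pow_left₀ (norm_nonneg _) h1 2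
  have h3 : 2 * ‖p‖ * ‖q‖ ≤ η * ‖p‖ ^ 2 + (1 / η) * ‖q‖ ^ 2 := by
    -- `0 ≤ (η‖p‖ − ‖q‖)² / η = η‖p‖² − 2‖p‖‖q‖ + ‖q‖²/η`
    have hsq : 0 ≤ (η * ‖p‖ - ‖q‖) ^ 2 / η := div_nonneg (sq_nonneg _) hη.le
    have hexp : (η * ‖p‖ - ‖q‖) ^ 2 / η = η * ‖p‖ ^ 2 + (1 / η) * ‖q‖ ^ 2 - 2 * ‖p‖ * ‖q‖ := by
      field_simp
      ring
    linarith
  nlinarith [norm_nonneg p, norm_nonneg q]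

/-- `‖L_{ij} x‖ ≤ 2‖x‖`. [folklore] -/
theorem norm_angularField_le (i j : Fin 4) (x : 𝔼) : ‖angularField 𝕓 i j x‖ ≤ 2 * ‖x‖ := by
  rw [angularField_apply]
  have hb : ∀ k, ‖(𝕓 : OrthonormalBasis (Fin 4) ℝ 𝔼) k‖ = 1 := fun k =>
    (EuclideanSpace.basisFun (Fin 4) ℝ).orthonormal.1 k
  calc ‖⟪x, 𝕓 i⟫ • 𝕓 j - ⟪x, 𝕓 j⟫ • 𝕓 i‖ ≤ ‖⟪x, 𝕓 i⟫ • 𝕓 j‖ + ‖⟪x, 𝕓 j⟫ • 𝕓 i‖ := norm_sub_le _ _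
    _ = |⟪x, 𝕓 i⟫| + |⟪x, 𝕓 j⟫| := by rw [norm_smul, norm_smul, hb, hb, mul_one, mul_one,
        Real.norm_eq_abs, Real.norm_eq_abs]
    _ ≤ ‖x‖ * ‖(𝕓 : OrthonormalBasis (Fin 4) ℝ 𝔼) i‖ + ‖x‖ * ‖(𝕓 : OrthonormalBasis (Fin 4) ℝ 𝔼) j‖ :=
        add_le_add (abs_real_inner_le_norm _ _) (abs_real_inner_le_norm _ _)
    _ = 2 * ‖x‖ := by rw [hb, hb]; ring

/-- `(∑ₐ cₐ)² ≤ 4 ∑ₐ cₐ²` on `Fin 4`. [folklore] -/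
theorem sq_sum_fin4_le (c : Fin 4 → ℝ) : (∑ a, c a) ^ 2 ≤ 4 * ∑ a, c a ^ 2 := by
  have h := sq_sum_le_card_mul_sum_sq (s := (Finset.univ : Finset (Fin 4))) (f := c)
  simpa using h

/-! ### Smoothness and the derivative/covariant-derivative dictionary -/

section Setting

/-- The Hodge-dual sections of a `C³` connection are `C²`. [folklore] -/
theorem contDiff_hodgeSec {B : Connection 𝔼 𝔤} (hB : ContDiff ℝ 3 B) (a : Fin 4) :
    ContDiff ℝ 2 (hodgeSec 𝕓 B a) := by
  have hB21 : ContDiff ℝ ((2 : WithTop ℕ∞) + 1) B := by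
    rw [show ((2 : WithTop ℕ∞) + 1) = 3 by norm_num]; exact hB
  have hF : ∀ c d, ContDiff ℝ 2 (fun x => curvature B x (𝕓 c) (𝕓 d)) := fun c d =>
    contDiff_curvature_apply (k := 2) hB21 _ _
  have hlin : ∀ b c d, ContDiff ℝ 2 (fun x : 𝔼 => ((lc4 a b c d : ℤ) : ℝ) * ⟪x, 𝕓 b⟫) := fun b c d =>
    contDiff_const.mul (contDiff_id.inner ℝ contDiff_const)
  unfold hodgeSec
  refine ContDiff.const_smul (1 / 2 : ℝ) ?_
  refine ContDiff.sum fun b _ => ContDiff.sum fun c _ => ContDiff.sum fun d _ => ?_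
  exact (hlin b c d).smul (hF c d)

/-- `∂ᵥφ = Dᵥφ − [B_v, φ]`. [folklore] -/
theorem fderiv_eq_covDeriv_sub (B : Connection 𝔼 𝔤) (φ : 𝔼 → 𝔤) (x v : 𝔼) :
    fderiv ℝ φ x v = covDeriv B φ x v - ⁅B x v, φ x⁆ := by
  unfold covDeriv; abel

/-- Continuity of `x ↦ D_{L_{ij}x} u_a(x)`. [folklore] -/
theorem continuous_covDeriv_hodgeSec_angular {B : Connection 𝔼 𝔤} (hB : ContDiff ℝ 3 B) (a i j : Fin 4) :
    Continuous fun x => covDeriv B (hodgeSec 𝕓 B a) x (angularField 𝕓 i j x) := by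
  have hu := contDiff_hodgeSec hB a
  unfold covDeriv
  refine Continuous.add ?_ ?_
  · exact ((hu.continuous_fderiv (by norm_num))).clm_apply (continuous_angularField 𝕓 i j)
  · have hBc : Continuous fun x => B x (angularField 𝕓 i j x) :=
      hB.continuous.clm_apply (continuous_angularField 𝕓 i j)
    have huc : Continuous (hodgeSec 𝕓 B a) := hu.continuous
    simp only [Ring.lie_def]
    exact (hBc.mul huc).sub (huc.mul hBc)

end Setting

/-! ### The covariant gap -/

set_option maxHeartbeats 1600000 in
/-- **The covariant gap `3` on `S_r` in a small gauge.** For a `C³` matrix-valued connection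
`B` on `ℝ⁴` with `‖B(y)v‖ ≤ (δ/r)‖v‖` on the sphere `‖y‖ = r` (`0 < δ ≤ 1`, `r > 0`), the
Hodge-dual sections `u_a = hodgeSec e B a` satisfy
`3 ∑ₐ ∮‖u_a‖² ≤ (1 + δ) ½∑ᵢⱼ∑ₐ ∮‖D_{L_{ij}}u_a‖² + 304 δ ∑ₐ ∮‖u_a‖²` on `S_r`.
[cite: Waldron2019, Lemma 3.5(a)] -/
theorem sphere_covariant_gap_small {B : Connection 𝔼 𝔤} (hB : ContDiff ℝ 3 B) {r δ : ℝ}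
    (hr : 0 < r) (hδ0 : 0 < δ) (hδ1 : δ ≤ 1)
    (hsmall : ∀ y : 𝔼, ‖y‖ = r → ∀ v : 𝔼, ‖B y v‖ ≤ δ / r * ‖v‖) :
    3 * ∑ a, sphereIntegral (volume : Measure 𝔼) (fun x => ‖hodgeSec 𝕓 B a x‖ ^ 2) r ≤
      (1 + δ) * ((1 / 2) * ∑ i, ∑ j, ∑ a, sphereIntegral (volume : Measure 𝔼)
          (fun x => ‖covDeriv B (hodgeSec 𝕓 B a) x (angularField 𝕓 i j x)‖ ^ 2) r) +
        304 * δ * ∑ a, sphereIntegral (volume : Measure 𝔼) (fun x => ‖hodgeSec 𝕓 B a x‖ ^ 2) r := by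
  haveI : Nontrivial 𝔼 := inferInstance
  set u : Fin 4 → 𝔼 → 𝔤 := fun a => hodgeSec 𝕓 B a with hu_def
  have hB2 : ContDiff ℝ 2 B := hB.of_le (by norm_num)
  have hu2 : ∀ a, ContDiff ℝ 2 (u a) := fun a => contDiff_hodgeSec hB a
  have huc : ∀ a, Continuous (u a) := fun a => (hu2 a).continuous
  have hDuc : ∀ a, Continuous (fderiv ℝ (u a)) := fun a => (hu2 a).continuous_fderiv (by norm_num)
  have htan : ∀ x : 𝔼, ∑ a, ⟪x, 𝕓 a⟫ • u a x = 0 := fun x => sum_inner_smul_hodgeSec_eq_zero 𝕓 B x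
  -- ### the flat gap
  have hflat := sphere_gap_tangential (n := 4) (V := 𝔤) (by norm_num) (u := u)
    (fun a => (hu2 a).contDiffOn) htan hr
  simp only [Nat.cast_ofNat] at hflat
  -- abbreviations
  set U : ℝ := ∑ a, sphereIntegral (volume : Measure 𝔼) (fun x => ‖u a x‖ ^ 2) r with hU
  set X : ℝ := (1 / 2) * ∑ i, ∑ j, ∑ a, sphereIntegral (volume : Measure 𝔼)
    (fun x => ‖covDeriv B (u a) x (angularField 𝕓 i j x)‖ ^ 2) r with hX
  have hUnn : 0 ≤ U := Finset.sum_nonneg fun a _ => sphereIntegral_nonneg' (fun x => sq_nonneg _) r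
  have hXnn : 0 ≤ X := by
    refine mul_nonneg (by norm_num) (Finset.sum_nonneg fun i _ => Finset.sum_nonneg fun j _ =>
      Finset.sum_nonneg fun a _ => sphereIntegral_nonneg' (fun x => sq_nonneg _) r)
  -- `U` as a single sphere integral
  have hUint : sphereIntegral (volume : Measure 𝔼) (fun x => ∑ a, ‖u a x‖ ^ 2) r = U := by
    rw [hU, sphereIntegral_finset_sum Finset.univ (g := fun a x => ‖u a x‖ ^ 2)
      (fun a _ => ((huc a).norm.pow 2).continuousOn) hr]
  -- ### the divergence term: `∑ₐ ∂ₐu_a = −∑ₐ [B_a, u_a]`, `‖·‖² ≤ 16(δ/r)² ∑‖u_a‖²`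
  have hdiv_pt : ∀ x : 𝔼, ∑ a, fderiv ℝ (u a) x (𝕓 a) = -∑ a, ⁅B x (𝕓 a), u a x⁆ := by
    intro x
    have h0 := sum_covDeriv_hodgeSec_eq_zero 𝕓 hB2 x
    simp_rw [hu_def, fderiv_eq_covDeriv_sub B, Finset.sum_sub_distrib]
    rw [h0, zero_sub]
  have hb1 : ∀ k, ‖(𝕓 : OrthonormalBasis (Fin 4) ℝ 𝔼) k‖ = 1 := fun k =>
    (EuclideanSpace.basisFun (Fin 4) ℝ).orthonormal.1 k
  have hdiv_bd : ∀ x : 𝔼, ‖x‖ = r →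
      ‖∑ a, fderiv ℝ (u a) x (𝕓 a)‖ ^ 2 ≤ 16 * (δ / r) ^ 2 * ∑ a, ‖u a x‖ ^ 2 := by
    intro x hx
    rw [hdiv_pt x, norm_neg]
    have h1 : ‖∑ a, ⁅B x (𝕓 a), u a x⁆‖ ≤ ∑ a, 2 * (δ / r) * ‖u a x‖ := by
      refine (norm_sum_le _ _).trans (Finset.sum_le_sum fun a _ => ?_)
      refine (norm_lie_le' _ _).trans ?_
      have hBa : ‖B x (𝕓 a)‖ ≤ δ / r := by
        have := hsmall x hx (𝕓 a); rwa [hb1, mul_one] at this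
      have := mul_le_mul_of_nonneg_right hBa (norm_nonneg (u a x))
      nlinarith [norm_nonneg (u a x), norm_nonneg (B x (𝕓 a))]
    have hnn : 0 ≤ ∑ a, 2 * (δ / r) * ‖u a x‖ :=
      Finset.sum_nonneg fun a _ => by positivity
    calc ‖∑ a, ⁅B x (𝕓 a), u a x⁆‖ ^ 2 ≤ (∑ a, 2 * (δ / r) * ‖u a x‖) ^ 2 :=
          pow_le_pow_left₀ (norm_nonneg _) h1 2
      _ = (2 * (δ / r)) ^ 2 * (∑ a, ‖u a x‖) ^ 2 := by rw [← Finset.mul_sum]; ring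
      _ ≤ (2 * (δ / r)) ^ 2 * (4 * ∑ a, ‖u a x‖ ^ 2) :=
          mul_le_mul_of_nonneg_left (sq_sum_fin4_le _) (sq_nonneg _)
      _ = 16 * (δ / r) ^ 2 * ∑ a, ‖u a x‖ ^ 2 := by ring
  have hdiv_int : sphereIntegral (volume : Measure 𝔼)
      (fun x => ‖∑ a, fderiv ℝ (u a) x (𝕓 a)‖ ^ 2) r ≤ 16 * (δ / r) ^ 2 * U := by
    have hc1 : Continuous fun x : 𝔼 => ‖∑ a, fderiv ℝ (u a) x (𝕓 a)‖ ^ 2 :=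
      ((continuous_finsetSum _ fun a _ => (hDuc a).clm_apply continuous_const).norm).pow 2
    have hc2 : Continuous fun x : 𝔼 => 16 * (δ / r) ^ 2 * ∑ a, ‖u a x‖ ^ 2 :=
      continuous_const.mul (continuous_finsetSum _ fun a _ => ((huc a).norm).pow 2)
    refine (sphereIntegral_mono_of_norm hc1.continuousOn hc2.continuousOn hr hdiv_bd).trans ?_
    rw [sphereIntegral_mul_left, hUint]
  -- ### the angular terms: `‖∂_L u_a‖² ≤ (1+δ)‖D_L u_a‖² + (1+1/δ)16δ²‖u_a‖²`
  have hang_bd : ∀ i j a, ∀ x : 𝔼, ‖x‖ = r →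
      ‖fderiv ℝ (u a) x (angularField 𝕓 i j x)‖ ^ 2 ≤
        (1 + δ) * ‖covDeriv B (u a) x (angularField 𝕓 i j x)‖ ^ 2 +
          (1 + 1 / δ) * (16 * δ ^ 2) * ‖u a x‖ ^ 2 := by
    intro i j a x hx
    rw [fderiv_eq_covDeriv_sub B (u a) x]
    refine (norm_sub_sq_le_weighted _ _ hδ0).trans ?_
    have hq : ‖⁅B x (angularField 𝕓 i j x), u a x⁆‖ ≤ 4 * δ * ‖u a x‖ := by
      refine (norm_lie_le' _ _).trans ?_
      have hBL : ‖B x (angularField 𝕓 i j x)‖ ≤ 2 * δ := by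
        refine (hsmall x hx _).trans ?_
        have hL := norm_angularField_le i j x
        rw [hx] at hL
        calc δ / r * ‖angularField 𝕓 i j x‖ ≤ δ / r * (2 * r) :=
              mul_le_mul_of_nonneg_left hL (by positivity)
          _ = 2 * δ := by field_simp
      nlinarith [norm_nonneg (u a x), norm_nonneg (B x (angularField 𝕓 i j x))]
    have hq2 : ‖⁅B x (angularField 𝕓 i j x), u a x⁆‖ ^ 2 ≤ 16 * δ ^ 2 * ‖u a x‖ ^ 2 := by
      calc ‖⁅B x (angularField 𝕓 i j x), u a x⁆‖ ^ 2 ≤ (4 * δ * ‖u a x‖) ^ 2 :=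
            pow_le_pow_left₀ (norm_nonneg _) hq 2
        _ = 16 * δ ^ 2 * ‖u a x‖ ^ 2 := by ring
    have hcoef : 0 ≤ 1 + 1 / δ := by positivity
    nlinarith [mul_le_mul_of_nonneg_left hq2 hcoef]
  have hang_int : ∀ i j a, sphereIntegral (volume : Measure 𝔼)
      (fun x => ‖fderiv ℝ (u a) x (angularField 𝕓 i j x)‖ ^ 2) r ≤
      (1 + δ) * sphereIntegral (volume : Measure 𝔼)
          (fun x => ‖covDeriv B (u a) x (angularField 𝕓 i j x)‖ ^ 2) r +
        (1 + 1 / δ) * (16 * δ ^ 2) * sphereIntegral (volume : Measure 𝔼) (fun x => ‖u a x‖ ^ 2) r := by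
    intro i j a
    have hc1 : Continuous fun x : 𝔼 => ‖fderiv ℝ (u a) x (angularField 𝕓 i j x)‖ ^ 2 :=
      (((hDuc a).clm_apply (continuous_angularField 𝕓 i j)).norm).pow 2
    have hcD : Continuous fun x : 𝔼 => ‖covDeriv B (u a) x (angularField 𝕓 i j x)‖ ^ 2 :=
      ((continuous_covDeriv_hodgeSec_angular hB a i j).norm).pow 2
    have hcu : Continuous fun x : 𝔼 => ‖u a x‖ ^ 2 := ((huc a).norm).pow 2
    have hm1 : Continuous fun x : 𝔼 => (1 + δ) * ‖covDeriv B (u a) x (angularField 𝕓 i j x)‖ ^ 2 :=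
      continuous_const.mul hcD
    have hm2 : Continuous fun x : 𝔼 => (1 + 1 / δ) * (16 * δ ^ 2) * ‖u a x‖ ^ 2 :=
      continuous_const.mul hcu
    have hc2 : Continuous fun x : 𝔼 =>
        (1 + δ) * ‖covDeriv B (u a) x (angularField 𝕓 i j x)‖ ^ 2 +
          (1 + 1 / δ) * (16 * δ ^ 2) * ‖u a x‖ ^ 2 := hm1.add hm2
    refine (sphereIntegral_mono_of_norm hc1.continuousOn hc2.continuousOn hr (hang_bd i j a)).trans ?_
    rw [sphereIntegral_add_of (fun x : 𝔼 => (1 + δ) * ‖covDeriv B (u a) x (angularField 𝕓 i j x)‖ ^ 2)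
      (fun x : 𝔼 => (1 + 1 / δ) * (16 * δ ^ 2) * ‖u a x‖ ^ 2) hm1.continuousOn hm2.continuousOn hr,
      sphereIntegral_mul_left, sphereIntegral_mul_left]
  have hang_sum : (1 / 2) * ∑ i, ∑ j, ∑ a, sphereIntegral (volume : Measure 𝔼)
      (fun x => ‖fderiv ℝ (u a) x (angularField 𝕓 i j x)‖ ^ 2) r ≤
      (1 + δ) * X + 128 * ((1 + 1 / δ) * δ ^ 2) * U := by
    have h1 : ∑ i : Fin 4, ∑ j : Fin 4, ∑ a, sphereIntegral (volume : Measure 𝔼)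
        (fun x => ‖fderiv ℝ (u a) x (angularField 𝕓 i j x)‖ ^ 2) r ≤
        ∑ i : Fin 4, ∑ j : Fin 4, ∑ a, ((1 + δ) * sphereIntegral (volume : Measure 𝔼)
            (fun x => ‖covDeriv B (u a) x (angularField 𝕓 i j x)‖ ^ 2) r +
          (1 + 1 / δ) * (16 * δ ^ 2) * sphereIntegral (volume : Measure 𝔼) (fun x => ‖u a x‖ ^ 2) r) :=
      Finset.sum_le_sum fun i _ => Finset.sum_le_sum fun j _ => Finset.sum_le_sum fun a _ =>
        hang_int i j a
    have h2 : ∑ i : Fin 4, ∑ j : Fin 4, ∑ a, ((1 + δ) * sphereIntegral (volume : Measure 𝔼)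
            (fun x => ‖covDeriv B (u a) x (angularField 𝕓 i j x)‖ ^ 2) r +
          (1 + 1 / δ) * (16 * δ ^ 2) * sphereIntegral (volume : Measure 𝔼) (fun x => ‖u a x‖ ^ 2) r) =
        (1 + δ) * (∑ i : Fin 4, ∑ j : Fin 4, ∑ a, sphereIntegral (volume : Measure 𝔼)
            (fun x => ‖covDeriv B (u a) x (angularField 𝕓 i j x)‖ ^ 2) r) +
          16 * ((1 + 1 / δ) * (16 * δ ^ 2) * U) := by
      simp only [Finset.sum_add_distrib, ← Finset.mul_sum, Finset.sum_const, Finset.card_univ,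
        Fintype.card_fin, nsmul_eq_mul, hU]
      push_cast
      ring
    rw [h2] at h1
    rw [hX]
    nlinarith [h1]
  -- ### assemble
  have hδ2 : δ ^ 2 ≤ δ := by nlinarith
  have h48 : 3 * r ^ 2 * (16 * (δ / r) ^ 2 * U) = 48 * δ ^ 2 * U := by
    calc 3 * r ^ 2 * (16 * (δ / r) ^ 2 * U) = 48 * U * ((δ / r) ^ 2 * r ^ 2) := by ring
      _ = 48 * U * δ ^ 2 := by rw [div_pow, div_mul_cancel₀ _ (pow_ne_zero 2 hr.ne')]
      _ = 48 * δ ^ 2 * U := by ring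
  have hkey : (1 + 1 / δ) * δ ^ 2 = δ ^ 2 + δ := by
    have h1 : 1 / δ * δ ^ 2 = δ := by
      rw [one_div, sq, ← mul_assoc, inv_mul_cancel₀ hδ0.ne', one_mul]
    rw [add_mul, one_mul, h1]
  rw [hkey] at hang_sum
  have hflat' : 3 * U ≤ (1 + δ) * X + 128 * (δ ^ 2 + δ) * U + 48 * δ ^ 2 * U := by
    have h3 := mul_le_mul_of_nonneg_left hdiv_int (by positivity : (0 : ℝ) ≤ 3 * r ^ 2)
    rw [h48] at h3
    have e1 : (4 - 1 : ℝ) = 3 := by norm_num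
    rw [e1] at hflat
    exact hflat.trans (add_le_add hang_sum h3)
  nlinarith [hflat', hδ2, hUnn, hXnn]

end Literature.MathematicalPhysics.QuantumLattice
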